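import Summits.Ventures.Crystal3D.Bulk.CapBoxCheck
import Summits.Ventures.Crystal3D.Bulk.CapCutCheck
import HarnessLib

/-!
# The kernel polynomial of a cap certificate as a dense tensor, and inequality (II) from the box check

Venture `Crystal3D` (cell `pub-crystal3d`, phase 2; seat typer-bulk). For a cap certificate
`c : CapCert` (`Literature…BachocVallentin.CapCert`: cap level `u₀`, row bases `W`, PSD factors `L_k`),
the kernel `K(u,v,t) = Σ_k Q3 k (u,v,t) · Σ_r g_{k,r}(u) g_{k,r}(v)` is expanded INSIDE Lean into a dense
rational tensor `kernelPoly3 c` (`[i][j][k] ↔ uⁱ vʲ tᵏ`; the zonal factors by the tree's Chebyshev recursion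
`Q₀ = 1, Q₁ = t - uv, Q_{k+2} = 2(t-uv) Q_{k+1} - (1-u²)(1-v²) Q_k`), with `eval3_kernelPoly3 : eval3 … = c.kernel`.
Then `checkII c λ n NB NGB fuel := checkPos3 (pad3 n (-(K + λ))) n u₀ 1 u₀ 1 (-1) (1/2) …` and
**`ineqII_of_checkII : checkII … = true → c.IneqII (1/2) λ`** — inequality (II) of the cap-cut certificates
(`CapCutCheck.lean`, seat p3) from ONE Boolean evaluation (by `decide` or `native_decide` elsewhere).
HONEST FRAMING: bookkeeping [folklore]; the Bachoc–Vallentin content is in the Literature file and in p3's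
`capCodeBound_of_capCert`; nothing is evaluated in this file.
-/

open Finset
open Literature.Geometry.DiscreteGeometry.BachocVallentin
open Literature.Analysis.SpecialFunctions

namespace Summit.Ventures.Crystal3D.CapCut.Bern

variable {α β : Type}

/-! ### Construction -/

/-- Outer product `P[i][j] = gᵢ · hⱼ` (a `(u,v)`-polynomial). [folklore] -/
def outer1 (g h : QT1) : QT2 := g.map fun gi => qsmul1 gi h
/-- `Σ_{r<m} g_{k,r}(u) g_{k,r}(v)` as a `(u,v)`-polynomial. [folklore] -/
def blockPoly2N (c : CapCert) (k : ℕ) : ℕ → QT2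
  | 0 => []
  | r + 1 => qadd2 (blockPoly2N c k r) (outer1 (gPolyN c k r (c.rows k)) (gPolyN c k r (c.rows k)))
/-- A `(u,v)`-polynomial as a trivariate tensor (degree `0` in `t`). [folklore] -/
def lift2 (p : QT2) : QT3 := p.map fun row => row.map fun x => [x]
/-- Product of `(v,t)`-slices. [folklore] -/
def mul2 : QT2 → QT2 → QT2
  | [], _ => []
  | a :: p, q => qadd2 (q.map fun b => pmul a b) ([] :: mul2 p q)
/-- Product of tensors. [folklore] -/
def mul3 : QT3 → QT3 → QT3
  | [], _ => []
  | a :: p, q => qadd3 (q.map fun b => mul2 a b) ([] :: mul3 p q)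
/-- The monomial `c · uⁱ vʲ tᵏ`. [folklore] -/
def monom3 (i j k : ℕ) (c : ℚ) : QT3 :=
  List.replicate i [] ++ [List.replicate j [] ++ [List.replicate k 0 ++ [c]]]
/-- `a = 2(t - uv)`. [folklore] -/
def aQ3 : QT3 := qadd3 (monom3 0 0 1 2) (monom3 1 1 0 (-2))
/-- `w = (1-u²)(1-v²) = 1 - u² - v² + u²v²`. [folklore] -/
def wQ3 : QT3 := qadd3 (qadd3 (monom3 0 0 0 1) (monom3 2 0 0 (-1))) (qadd3 (monom3 0 2 0 (-1)) (monom3 2 2 0 1))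
/-- `(Q3 k, Q3 (k+1))` (zonal factors) by the Chebyshev recursion. [folklore] -/
def chebPair : ℕ → QT3 × QT3
  | 0 => ([[[1]]], qsmul3 (1 / 2) aQ3)
  | k + 1 =>
    let p := chebPair k
    (p.2, qadd3 (mul3 aQ3 p.2) (qsmul3 (-1) (mul3 wQ3 p.1)))
/-- The zonal factor `Q3 k` as a tensor. [folklore] -/
def chebQ3 (k : ℕ) : QT3 := (chebPair k).1
/-- `Σ_{k<K} Q3_k · (Σ_{r<R} g_{k,r} ⊗ g_{k,r})`. [folklore] -/
def kernelPoly3N (c : CapCert) : ℕ → QT3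
  | 0 => []
  | k + 1 => qadd3 (kernelPoly3N c k) (mul3 (chebQ3 k) (lift2 (blockPoly2N c k c.R)))
/-- **The kernel of a cap certificate as a dense tensor.** [cite: BachocVallentin2009, Theorem 4.4 (the polynomial F)] -/
def kernelPoly3 (c : CapCert) : QT3 := kernelPoly3N c c.L.length
/-- `-(K + λ)`. [folklore] -/
def negKerPoly3 (c : CapCert) (lam : ℚ) : QT3 := qadd3 (qsmul3 (-1) (kernelPoly3 c)) [[[-lam]]]
/-- Zero padding of a line to length `≥ n+1`. [folklore] -/
def pad1 (n : ℕ) (l : QT1) : QT1 := l ++ List.replicate (n + 1 - l.length) 0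
/-- Zero padding of a slice. [folklore] -/
def pad2 (n : ℕ) (l : QT2) : QT2 := (l ++ List.replicate (n + 1 - l.length) []).map (pad1 n)
/-- Zero padding of a tensor to shape `(n+1)³` (when no list is longer). [folklore] -/
def pad3 (n : ℕ) (l : QT3) : QT3 := (l ++ List.replicate (n + 1 - l.length) []).map (pad2 n)

/-- **The check of inequality (II)** of a cap certificate with constant `λ`: the box check for
`-(K + λ) ≥ 0` on `[u₀,1]² × [-1, 1/2] ∩ {Gram ≥ 0}` (tensor degree `n`, scales `2^NB`, `2^NGB`, depth `fuel`).
[folklore] -/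
def checkII (c : CapCert) (lam : ℚ) (n NB NGB fuel : ℕ) : Bool :=
  checkPos3 (pad3 n (negKerPoly3 c lam)) n c.u0 1 c.u0 1 (-1) (1 / 2) NB NGB fuel

/-! ### Semantics of the levels -/

/-- Value of a `t`-line. [folklore] -/
def ev1 (ln : QT1) (t : ℝ) : ℝ := pvF (fun q : ℚ => (q : ℝ)) ln t
/-- Value of a `(v,t)`-slice. [folklore] -/
def ev2 (sl : QT2) (v t : ℝ) : ℝ := pvF (fun ln => ev1 ln t) sl v
/-- Value of a `(u,v)`-polynomial. [folklore] -/
def evUV (p : QT2) (u v : ℝ) : ℝ := pvF (fun g => ev1 g v) p u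

/-- `eval3` through the slices. [folklore] -/
theorem eval3_eq (P : QT3) (u v t : ℝ) : eval3 P u v t = pvF (fun sl => ev2 sl v t) P u := rfl

/-- `pvF` and the Literature Horner evaluation agree. [folklore] -/
theorem ev1_eq_upolyEval : ∀ (ln : QT1) (t : ℝ), ev1 ln t = upolyEval ln t := by
  intro ln; induction ln with
  | nil => intro t; rfl
  | cons c cs ih => intro t; simp only [ev1, pvF, upolyEval] at ih ⊢; rw [ih]

/-- Additivity of `pvF` under `lzip`. [folklore] -/
theorem pvF_lzip {F : α → ℝ} {add : α → α → α} (hadd : ∀ x y, F (add x y) = F x + F y) :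
    ∀ (x y : List α) (s : ℝ), pvF F (lzip add x y) s = pvF F x s + pvF F y s := by
  intro x; induction x with
  | nil => intro y s; simp [lzip, pvF]
  | cons a x ih =>
    intro y s
    cases y with
    | nil => simp [lzip, pvF]
    | cons b y => simp only [lzip, pvF, hadd, ih]; ring

/-- `pvF` of a scaled list. [folklore] -/
theorem pvF_map_mul {F : α → ℝ} {F' : β → ℝ} (g : β → α) (c : ℝ) (h : ∀ w, F (g w) = c * F' w) :
    ∀ (l : List β) (s : ℝ), pvF F (l.map g) s = c * pvF F' l s := by
  intro l; induction l with
  | nil => intro s; simp [pvF]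
  | cons a l ih => intro s; simp only [List.map_cons, pvF, h, ih]; ring

/-- Trailing defaults do not change the value. [folklore] -/
theorem pvF_append_replicate {F : α → ℝ} {z : α} (hz : F z = 0) :
    ∀ (l : List α) (m : ℕ) (s : ℝ), pvF F (l ++ List.replicate m z) s = pvF F l s := by
  intro l; induction l with
  | nil =>
    intro m s
    induction m with
    | zero => rfl
    | succ m ih => simp only [List.nil_append, List.replicate_succ, pvF, hz] at ih ⊢; rw [ih]; ring
  | cons a l ih => intro m s; simp only [List.cons_append, pvF, ih]

/-- A monomial line: `pvF (replicate i z ++ [a]) s = sⁱ · F a`. [folklore] -/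
theorem pvF_replicate_single {F : α → ℝ} {z : α} (hz : F z = 0) (a : α) :
    ∀ (i : ℕ) (s : ℝ), pvF F (List.replicate i z ++ [a]) s = s ^ i * F a := by
  intro i; induction i with
  | zero => intro s; simp [pvF]
  | succ i ih => intro s; simp only [List.replicate_succ, List.cons_append, pvF, hz, ih]; ring

/-! ### Semantics of the operations -/

/-- Value of a sum of lines. [folklore] -/
theorem ev1_qadd1 (a b : QT1) (t : ℝ) : ev1 (qadd1 a b) t = ev1 a t + ev1 b t :=
  pvF_lzip (F := fun q : ℚ => (q : ℝ)) (fun x y => by push_cast; ring) a b t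

/-- Value of a scaled line. [folklore] -/
theorem ev1_qsmul1 (c : ℚ) (a : QT1) (t : ℝ) : ev1 (qsmul1 c a) t = (c : ℝ) * ev1 a t :=
  pvF_map_mul (F := fun q : ℚ => (q : ℝ)) (F' := fun q : ℚ => (q : ℝ)) (c * ·) (c : ℝ)
    (fun w => by push_cast; ring) a t

/-- Value of a product of lines (via `CapCut.eval_pmul`). [folklore] -/
theorem ev1_pmul (a b : QT1) (t : ℝ) : ev1 (pmul a b) t = ev1 a t * ev1 b t := by
  simp only [ev1_eq_upolyEval, eval_pmul]

/-- Value of a sum of slices. [folklore] -/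
theorem ev2_qadd2 (a b : QT2) (v t : ℝ) : ev2 (qadd2 a b) v t = ev2 a v t + ev2 b v t :=
  pvF_lzip (F := fun ln => ev1 ln t) (fun x y => ev1_qadd1 x y t) a b v

/-- Value of a scaled slice. [folklore] -/
theorem ev2_qsmul2 (c : ℚ) (a : QT2) (v t : ℝ) : ev2 (qsmul2 c a) v t = (c : ℝ) * ev2 a v t :=
  pvF_map_mul (F := fun ln => ev1 ln t) (F' := fun ln => ev1 ln t) (qsmul1 c) (c : ℝ)
    (fun w => ev1_qsmul1 c w t) a v

/-- Value of a product of slices. [folklore] -/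
theorem ev2_mul2 : ∀ (p q : QT2) (v t : ℝ), ev2 (mul2 p q) v t = ev2 p v t * ev2 q v t := by
  intro p; induction p with
  | nil => intro q v t; simp [mul2, ev2, pvF]
  | cons a p ih =>
    intro q v t
    rw [mul2, ev2_qadd2, show ev2 (q.map fun b => pmul a b) v t = ev1 a t * ev2 q v t from
      pvF_map_mul (F := fun ln => ev1 ln t) (F' := fun ln => ev1 ln t) _ _ (fun w => ev1_pmul a w t) q v,
      show ev2 ([] :: mul2 p q) v t = ev1 [] t + v * ev2 (mul2 p q) v t from rfl, ih,
      show ev2 (a :: p) v t = ev1 a t + v * ev2 p v t from rfl, show ev1 ([] : QT1) t = 0 from rfl]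
    ring

/-- Value of a sum of tensors. [folklore] -/
theorem eval3_qadd3 (a b : QT3) (u v t : ℝ) : eval3 (qadd3 a b) u v t = eval3 a u v t + eval3 b u v t :=
  pvF_lzip (F := fun sl => ev2 sl v t) (fun x y => ev2_qadd2 x y v t) a b u

/-- Value of a scaled tensor. [folklore] -/
theorem eval3_qsmul3 (c : ℚ) (a : QT3) (u v t : ℝ) : eval3 (qsmul3 c a) u v t = (c : ℝ) * eval3 a u v t :=
  pvF_map_mul (F := fun sl => ev2 sl v t) (F' := fun sl => ev2 sl v t) (qsmul2 c) (c : ℝ)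
    (fun w => ev2_qsmul2 c w v t) a u

/-- Value of a product of tensors. [folklore] -/
theorem eval3_mul3 : ∀ (p q : QT3) (u v t : ℝ), eval3 (mul3 p q) u v t = eval3 p u v t * eval3 q u v t := by
  intro p; induction p with
  | nil => intro q u v t; simp [mul3, eval3, pvF]
  | cons a p ih =>
    intro q u v t
    rw [mul3, eval3_qadd3, show eval3 (q.map fun b => mul2 a b) u v t = ev2 a v t * eval3 q u v t from
      pvF_map_mul (F := fun sl => ev2 sl v t) (F' := fun sl => ev2 sl v t) _ _ (fun w => ev2_mul2 a w v t) q u,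
      show eval3 ([] :: mul3 p q) u v t = ev2 [] v t + u * eval3 (mul3 p q) u v t from rfl, ih,
      show eval3 (a :: p) u v t = ev2 a v t + u * eval3 p u v t from rfl, show ev2 ([] : QT2) v t = 0 from rfl]
    ring

/-- Value of a monomial. [folklore] -/
theorem eval3_monom3 (i j k : ℕ) (c : ℚ) (u v t : ℝ) :
    eval3 (monom3 i j k c) u v t = (c : ℝ) * u ^ i * v ^ j * t ^ k := by
  rw [eval3_eq, monom3, pvF_replicate_single (F := fun sl => ev2 sl v t) (by simp [ev2, pvF])]
  simp only [ev2]
  rw [pvF_replicate_single (F := fun ln => ev1 ln t) (by simp [ev1, pvF])]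
  simp only [ev1]
  rw [pvF_replicate_single (F := fun q : ℚ => (q : ℝ)) (by simp)]
  ring

/-- `a = 2(t - uv)`. [folklore] -/
theorem eval3_aQ3 (u v t : ℝ) : eval3 aQ3 u v t = 2 * (t - u * v) := by
  simp only [aQ3, eval3_qadd3, eval3_monom3]; push_cast; ring

/-- `w = (1-u²)(1-v²)`. [folklore] -/
theorem eval3_wQ3 (u v t : ℝ) : eval3 wQ3 u v t = (1 - u ^ 2) * (1 - v ^ 2) := by
  simp only [wQ3, eval3_qadd3, eval3_monom3]; push_cast; ring

/-- The Chebyshev pair evaluates to `(chebHom k, chebHom (k+1))` at `(2(t-uv), (1-u²)(1-v²))`. [folklore] -/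
theorem eval3_chebPair : ∀ (k : ℕ) (u v t : ℝ),
    eval3 (chebPair k).1 u v t = chebHom k (2 * (t - u * v)) ((1 - u ^ 2) * (1 - v ^ 2)) ∧
      eval3 (chebPair k).2 u v t = chebHom (k + 1) (2 * (t - u * v)) ((1 - u ^ 2) * (1 - v ^ 2)) := by
  intro k; induction k with
  | zero =>
    intro u v t
    refine ⟨by simp [chebPair, eval3, pvF, chebHom], ?_⟩
    simp only [chebPair, eval3_qsmul3, eval3_aQ3]
    rw [show chebHom (0 + 1) (2 * (t - u * v)) ((1 - u ^ 2) * (1 - v ^ 2)) = 2 * (t - u * v) / 2 from rfl]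
    push_cast; ring
  | succ k ih =>
    intro u v t
    obtain ⟨h1, h2⟩ := ih u v t
    refine ⟨by simpa [chebPair] using h2, ?_⟩
    simp only [chebPair, eval3_qadd3, eval3_mul3, eval3_qsmul3, eval3_aQ3, eval3_wQ3, h1, h2]
    rw [show chebHom (k + 1 + 1) (2 * (t - u * v)) ((1 - u ^ 2) * (1 - v ^ 2)) =
      2 * (t - u * v) * chebHom (k + 1) (2 * (t - u * v)) ((1 - u ^ 2) * (1 - v ^ 2)) -
        (1 - u ^ 2) * (1 - v ^ 2) * chebHom k (2 * (t - u * v)) ((1 - u ^ 2) * (1 - v ^ 2)) from rfl]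
    push_cast; ring

/-- The zonal tensor evaluates to the tree's `Q3 k`. [cite: BachocVallentin2007, Theorem 3.2 (n = 3)] -/
theorem eval3_chebQ3 (k : ℕ) (u v t : ℝ) : eval3 (chebQ3 k) u v t = Literature.Geometry.DiscreteGeometry.BachocVallentin.Q3 k u v t := by
  unfold chebQ3 Literature.Geometry.DiscreteGeometry.BachocVallentin.Q3; exact (eval3_chebPair k u v t).1

/-- Value of a lifted `(u,v)`-polynomial. [folklore] -/
theorem eval3_lift2 (p : QT2) (u v t : ℝ) : eval3 (lift2 p) u v t = evUV p u v := by
  rw [eval3_eq, lift2, pvF_map]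
  unfold evUV
  refine pvF_congr_mem p u fun row _ => ?_
  simp only [Function.comp, ev2]
  rw [pvF_map]
  refine pvF_congr_mem row v fun x _ => ?_
  simp [Function.comp, ev1, pvF]

/-- Value of a sum of `(u,v)`-polynomials. [folklore] -/
theorem evUV_qadd2 (a b : QT2) (u v : ℝ) : evUV (qadd2 a b) u v = evUV a u v + evUV b u v :=
  pvF_lzip (F := fun g => ev1 g v) (fun x y => ev1_qadd1 x y v) a b u

/-- Value of an outer product. [folklore] -/
theorem evUV_outer1 (g h : QT1) (u v : ℝ) : evUV (outer1 g h) u v = ev1 g u * ev1 h v := by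
  unfold evUV outer1
  rw [pvF_map_mul (F := fun g' => ev1 g' v) (F' := fun q : ℚ => (q : ℝ)) (fun gi => qsmul1 gi h) (ev1 h v)
    (fun w => by rw [ev1_qsmul1]; ring)]
  unfold ev1; ring

/-- `blockPoly2N` evaluates to `Σ_{r<m} g_{k,r}(u) g_{k,r}(v)`. [folklore] -/
theorem evUV_blockPoly2N (c : CapCert) (k : ℕ) (u v : ℝ) :
    ∀ m : ℕ, evUV (blockPoly2N c k m) u v = ∑ r ∈ range m, c.g k r u * c.g k r v := by
  intro m; induction m with
  | zero => simp [blockPoly2N, evUV, pvF]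
  | succ m ih =>
    rw [blockPoly2N, evUV_qadd2, ih, evUV_outer1, ev1_eq_upolyEval, ev1_eq_upolyEval, eval_gPolyN_rows,
      eval_gPolyN_rows, Finset.sum_range_succ]

/-- Partial sums of the kernel tensor. [folklore] -/
theorem eval3_kernelPoly3N (c : CapCert) (u v t : ℝ) :
    ∀ K : ℕ, eval3 (kernelPoly3N c K) u v t =
      ∑ k ∈ range K, Literature.Geometry.DiscreteGeometry.BachocVallentin.Q3 k u v t * ∑ r ∈ range c.R, c.g k r u * c.g k r v := by
  intro K; induction K with
  | zero => simp [kernelPoly3N, eval3, pvF]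
  | succ K ih =>
    rw [kernelPoly3N, eval3_qadd3, ih, eval3_mul3, eval3_chebQ3, eval3_lift2, evUV_blockPoly2N,
      Finset.sum_range_succ]

/-- **The tensor IS the kernel**: `eval3 (kernelPoly3 c) = c.kernel`. [cite: BachocVallentin2009, Theorem 4.4] -/
theorem eval3_kernelPoly3 (c : CapCert) (u v t : ℝ) : eval3 (kernelPoly3 c) u v t = c.kernel u v t := by
  rw [kernelPoly3, eval3_kernelPoly3N]
  unfold CapCert.kernel capKernel3
  refine Finset.sum_congr rfl fun k _ => ?_
  rw [Finset.mul_sum]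
  refine Finset.sum_congr rfl fun r _ => ?_; ring

/-- `eval3 (-(K+λ)) = -K - λ`. [folklore] -/
theorem eval3_negKerPoly3 (c : CapCert) (lam : ℚ) (u v t : ℝ) :
    eval3 (negKerPoly3 c lam) u v t = -c.kernel u v t - lam := by
  rw [negKerPoly3, eval3_qadd3, eval3_qsmul3, eval3_kernelPoly3]
  simp [eval3, pvF]; ring

/-- Padding does not change the value. [folklore] -/
theorem eval3_pad3 (n : ℕ) (P : QT3) (u v t : ℝ) : eval3 (pad3 n P) u v t = eval3 P u v t := by
  have h1 : ∀ ln : QT1, ev1 (pad1 n ln) t = ev1 ln t := fun ln =>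
    pvF_append_replicate (F := fun q : ℚ => (q : ℝ)) (by simp) ln _ t
  have h2 : ∀ sl : QT2, ev2 (pad2 n sl) v t = ev2 sl v t := by
    intro sl
    unfold ev2 pad2
    rw [pvF_map, pvF_append_replicate (F := (fun ln => ev1 ln t) ∘ pad1 n) (by show ev1 (pad1 n []) t = 0; rw [h1]; rfl)]
    exact pvF_congr_mem sl v fun ln _ => by simp [Function.comp, h1]
  rw [eval3_eq, eval3_eq, pad3, pvF_map,
    pvF_append_replicate (F := (fun sl => ev2 sl v t) ∘ pad2 n) (by show ev2 (pad2 n []) v t = 0; rw [h2]; rfl)]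
  exact pvF_congr_mem P u fun sl _ => by simp [Function.comp, h2]

/-! ### Inequality (II) from the check -/

/-- **Inequality (II) of a cap certificate from one Boolean**: if `checkII c λ n NB NGB fuel = true` then
`c.IneqII (1/2) λ`, i.e. `K(u,v,t) ≤ -λ` for `u, v ∈ [u₀, 1]`, `t ∈ [-1, 1/2]`, `1 + 2uvt - u² - v² - t² ≥ 0`.
[cite: BachocVallentin2009, Theorem 4.4 (c)] -/
theorem ineqII_of_checkII (c : CapCert) (lam : ℚ) (n NB NGB fuel : ℕ)
    (h : checkII c lam n NB NGB fuel = true) : c.IneqII (1 / 2) lam := by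
  intro u v t hu0 hu1 hv0 hv1 ht0 ht1 hg
  have h' := nonneg_of_checkPos3 _ n c.u0 1 c.u0 1 (-1) (1 / 2) NB NGB fuel h u v t hu0
    (by exact_mod_cast hu1) hv0 (by exact_mod_cast hv1) (by exact_mod_cast ht0) ht1 hg
  rw [eval3_pad3, eval3_negKerPoly3] at h'
  linarith

end Summit.Ventures.Crystal3D.CapCut.Bern
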